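/-
Copyright: statement-level skeleton of a published paper (lit-balaban cell, Phase-2 proof seat p10, gen 5). No proof claims
beyond what the kernel checks below.
-/
import Mathlib
import Literature.MathematicalPhysics.QuantumFieldTheory.BalabanImbrieJaffe1984to88.BIJ85FibreDualBound
import Literature.MathematicalPhysics.QuantumFieldTheory.BalabanImbrieJaffe1984to88.BIJ85FibreCrossTerms
import Literature.MathematicalPhysics.QuantumFieldTheory.BalabanImbrieJaffe1984to88.BIJ85Thm711AllLMultiplier
import Literature.MathematicalPhysics.QuantumFieldTheory.BalabanImbrieJaffe1984to88.BIJ85Thm711ConfigSpace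

/-!
# `BalabanImbrieJaffe1984to88.BIJ85Thm711AllL` — T. Bałaban, J. Imbrie, A. Jaffe, *Renormalization of the Higgs model:
minimizers, propagators and the stability of mean field theory*, Commun. Math. Phys. **97** (1985) 299–329
[BalabanImbrieJaffe1985]: **Theorem 7.1.1 p. 321 for EVERY block size n = L^k, even L included** — *"There exists a constant
c > 0, independent of k, such that c ≤ σ_k"* — in configuration space for the concrete torus operators (∂^η = n·`curlC`,
Q^{e*}_k = p27's `edgeAdjC`, Q_k = pub-balaban's `QvOp`), with the explicit constant `cAllL d` (last file of seat p10 gen 5's all-n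
chain `BIJ85FibreDuality`/`BIJ85FibreDualBound` → `BIJ85FibreCurlIntertwine` → `BIJ85FibreOffCentre`/`BIJ85FibreCrossTerms` →
`BIJ85Thm711AllLMultiplier` → this).
The tree's `BIJ85Thm711ConfigSpace.thm711_configSpace` is the case n = 2M+1 (r15's symmetric window `lShifts`); here the l-sums
run over the complete residue system k : Fin d → Fin n, so n is arbitrary — this closes the cell's scope note G-C1-p27-02.

statement-level skeleton of published theorems with citation tags; proofs where landed; nothing here is a claim about
the Yang–Mills mass gap

PDF held: `paper:balaban1985-cmp97-bij-higgs-minimizers` (journal page = PDF page + 298).  Renders read as images: PDF pp.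
23–27 (journal 321–325), `run/shared/lean/pub/pub-balaban/t4/b2b-balaban-t4-lit2/renders/bij1985/…-p023…p027-x2.png`.

CITATION HEADER (lean-in-tree rule).  Part of the lit-balaban TYPED SKELETON (HOME `run/shared/lean/pub/lit-balaban/`); WHAT IS
REPRODUCED: SKELETON row **C1.Thm7.1.1** (fold owner r15, `HOME/lit-balaban-r15/ROWS-C1.md`; head condition (i)) for all n.
THE PRINTED TEXT (p. 321 [PDF 23]): *"Theorem 7.1.1. There exists a constant c > 0, independent of k, such that c ≤ σ_k."*; the
printed proof (pp. 322–325): the fibre decomposition (7.1.12)–(7.1.13), σ = τ₀ + τ₁ + τ₂ (7.1.14)–(7.1.16), τ₁ = 0 on 𝒦 (7.1.18), the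
splitting 𝒦(p) = ∂ℋ(p) ⊕ (∂ℋ(p))^⊥ (7.1.19), |v_μ| ∈ [2/π, π/2] (7.1.20), ‖τ₂‖ ≤ M (7.1.23)–(7.1.24), and the assembly
(7.1.25)–(7.1.31) *"⟨f, σf⟩ ≥ … ≥ ε(‖f^⊥‖² + ‖∂B‖²) … which is bounded below by ε‖∂B‖² (see also [6I, 8])"*.  THE ROUTE
KERNEL-CHECKED HERE is the same argument in DUAL (Lagrangian) form, which needs no inverse of σ and no parity of n: by
`BIJ85FibreDualBound.dual_bound` the constrained infimum (7.1.12) is ≥ the value of the concave dual functional at the test pair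
(g, Λ) = (central source of f^⊥, δ·τ₂-multiplier of the curl part ∂B); the g-part reproduces τ₀ ≥ (4/π²)^d on f^⊥ ((7.1.20),
(7.1.28)–(7.1.29): the central divergence of f^⊥'s source VANISHES, `decomp_allL`), the Λ-part reproduces ⟨∂B, τ₂∂B⟩ = ⟨B, Δ_kB⟩ ≥
ε₁‖∂B‖² ((7.1.31), `BIJ85FibreCurlIntertwine.pairing_curl1` + gen-2 `BIJ85SigmaOnCurls325.lower_bound_eps`), and the only cross
term ΣΛ_νA_ν(f^⊥) is the off-centre τ₂-type quantity bounded uniformly in n by `BIJ85FibreCrossTerms` ((7.1.23)–(7.1.24)); a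
small δ = δ(d) absorbs it (constants, splitting `decomp_allL` and multiplier `lamK` with its identities: sibling
`BIJ85Thm711AllLMultiplier`).  WHAT IS KERNEL-CHECKED (zero `sorry`, standard axioms): `cFiveSq_pos`, `deltaC_mul_cFiveSq_le`
(2δC₅² ≤ ½(4/π²)^d); **`hfib_zero`** (p′ = 0), **`hfib_ne_zero`**, **`hfib_twoForm_allL`** (c|φ|² ≤ E_{p′}(α,φ), every n, every
p′, every antisymmetric φ, every constrained α); **`thm711_configSpace_allL`**, **`thm711_configSpace_allL_exists`** (Theorem
7.1.1 in configuration space, every n ≥ 1, every torus Π(ℤ/nN_μ), d ≥ 1, via p27's `thm711_config_of_fibre_twoForm`).  NOT CLAIMED: the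
identification of the printed σ_k (an inf over the infinite lattice / its transport, p33's `BIJ85Thm711Torus`) beyond p27's
configuration-space energy on the tori.  Unit `lit-balaban-p10` (gen 5), HOME as above.
-/

namespace Literature.MathematicalPhysics.QuantumFieldTheory.BalabanImbrieJaffe1984to88.BIJ85Thm711AllL

open scoped BigOperators ComplexConjugate Matrix
open Complex Finset
open Literature.MathematicalPhysics.QuantumFieldTheory.Balaban1983to89
open Literature.MathematicalPhysics.QuantumFieldTheory.Balaban1983to89.B5Prop11Plancherel
open Literature.MathematicalPhysics.QuantumFieldTheory.Balaban1983to89.B5Prop11Fiber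
open Literature.MathematicalPhysics.QuantumFieldTheory.Balaban1983to89.B5Block118
open Literature.MathematicalPhysics.QuantumFieldTheory.BalabanImbrieJaffe1984to88.BIJ85Eq715ConfigSymbols
open Literature.MathematicalPhysics.QuantumFieldTheory.BalabanImbrieJaffe1984to88.BIJ85Eq7111EdgeAverage
open Literature.MathematicalPhysics.QuantumFieldTheory.BalabanImbrieJaffe1984to88.BIJ85Eq7111EdgeAdjoint
open Literature.MathematicalPhysics.QuantumFieldTheory.BalabanImbrieJaffe1984to88.BIJ85Eq7112FibreEnergy
open Literature.MathematicalPhysics.QuantumFieldTheory.BalabanImbrieJaffe1984to88.BIJ85FibreDuality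
open Literature.MathematicalPhysics.QuantumFieldTheory.BalabanImbrieJaffe1984to88.BIJ85FibreDualBound
open Literature.MathematicalPhysics.QuantumFieldTheory.BalabanImbrieJaffe1984to88.BIJ85FibreCurlIntertwine
open Literature.MathematicalPhysics.QuantumFieldTheory.BalabanImbrieJaffe1984to88.BIJ85FibreOffCentre
open Literature.MathematicalPhysics.QuantumFieldTheory.BalabanImbrieJaffe1984to88.BIJ85FibreCrossTerms
open Literature.MathematicalPhysics.QuantumFieldTheory.BalabanImbrieJaffe1984to88.BIJ85CurlComplement719
  (IsTwoForm curlP PerpCurl projK gOf exists_decomp719_twoForm div_eq_zero_of_perp projK_conjTranspose projK_mul_projK)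
open Literature.MathematicalPhysics.QuantumFieldTheory.BalabanImbrieJaffe1984to88.BIJ85Tau2Kernel715
  (enn sqrtInv scl norm_sqrtInv_sq sum_norm_scl_sq projK_mulVec_self normSq_projK_mulVec norm_scl_curl_sq)
open Literature.MathematicalPhysics.QuantumFieldTheory.BalabanImbrieJaffe1984to88.BIJ85SigmaOnCurls325 (lower_bound_eps)
open Literature.MathematicalPhysics.QuantumFieldTheory.BalabanImbrieJaffe1984to88.BIJ85Thm711ConfigSpace
  (thm711_config_of_fibre_twoForm)

open Literature.MathematicalPhysics.QuantumFieldTheory.BalabanImbrieJaffe1984to88.BIJ85Thm711AllLMultiplier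
noncomputable section

variable {d : ℕ}

/-! ## §0 The absorption inequality for δ(d) -/

/-- C₅(d)² > 0 for d ≥ 1. [cite: BalabanImbrieJaffe1985, (7.1.24) p.324] -/
theorem cFiveSq_pos (hd : 0 < d) : 0 < cFiveSq d := by
  unfold cFiveSq
  have := phiMin_pos hd
  have : (0 : ℝ) < d := by exact_mod_cast hd
  positivity

/-- δ(d) = min(1, (4/π²)^d/(4C₅(d)²)) in terms of `cFiveSq`. [cite: BalabanImbrieJaffe1985, (7.1.27) p.324] -/
theorem deltaC_eq : deltaC d = min 1 ((4 / Real.pi ^ 2) ^ d / (4 * cFiveSq d)) := rfl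

/-- The absorption inequality 2δC₅² ≤ ½(4/π²)^d. [cite: BalabanImbrieJaffe1985, (7.1.27) p.324] -/
theorem deltaC_mul_cFiveSq_le (hd : 0 < d) : 2 * deltaC d * cFiveSq d ≤ (4 / Real.pi ^ 2) ^ d / 2 := by
  have hC := cFiveSq_pos hd
  have h : deltaC d ≤ (4 / Real.pi ^ 2) ^ d / (4 * cFiveSq d) := deltaC_eq (d := d) ▸ min_le_right _ _
  rw [le_div_iff₀ (by positivity)] at h
  linarith

/-! ## §1 Kernel lemmas -/

/-- kernel: the pairing of an antisymmetric G with a wedge e ∧ x is twice the pairing of x with the e-contraction of Ḡ. [folklore] -/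
private theorem pairing_antisymm (e x : Fin d → ℂ) (G : Fin d → Fin d → ℂ) (hG : ∀ μ ν, G ν μ = -G μ ν) :
    ∑ μ, ∑ ν, conj (G μ ν) * (e μ * x ν - e ν * x μ) = 2 * ∑ ν, x ν * ∑ μ, e μ * conj (G μ ν) := by
  have hterm : ∀ μ ν, conj (G μ ν) * (e μ * x ν - e ν * x μ)
      = x ν * (e μ * conj (G μ ν)) + x μ * (e ν * conj (G ν μ)) := by
    intro μ ν
    rw [show conj (G ν μ) = -conj (G μ ν) by rw [hG μ ν, map_neg]]
    ring
  simp_rw [hterm]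
  simp only [Finset.sum_add_distrib]
  rw [Finset.sum_comm (f := fun μ ν => x ν * (e μ * conj (G μ ν)))]
  simp only [← Finset.mul_sum]
  ring

/-- kernel: |x + y|² ≤ 2|x|² + 2|y|². [folklore] -/
private theorem norm_add_sq_le_two (x y : ℂ) : ‖x + y‖ ^ 2 ≤ 2 * ‖x‖ ^ 2 + 2 * ‖y‖ ^ 2 := by
  have h := pow_le_pow_left₀ (norm_nonneg _) (norm_add_le x y) 2
  nlinarith [sq_nonneg (‖x‖ - ‖y‖)]

/-- kernel: 2Re(z̄z) − |z|² = |z|². [folklore] -/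
private theorem two_re_conj_mul_self_sub (z : ℂ) : 2 * (conj z * z).re - ‖z‖ ^ 2 = ‖z‖ ^ 2 := by
  rw [Complex.conj_mul', ← Complex.ofReal_pow, Complex.ofReal_re]
  ring

section Fibre

variable (n : ℕ) [NeZero n] (M : Fin d → ℕ) [hM : ∀ μ, NeZero (M μ)]
/-! ## §4 The fibrewise bound, every n -/

/-- **The fibre p′ = 0** (every n): there ∂(p′) = 0, so the test family T_l = δ_{l0}·(central source of φ) with Λ = 0 is
dual-feasible and `weak_duality` gives E ≥ Σ_{μν}|w̄_{μν}(0)φ_{μν}|² ≥ (4/π²)^dΣ|φ_{μν}|² (all |v_ρ(0)| = 1 ≥ 2/π).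
[cite: BalabanImbrieJaffe1985, (7.1.20) p.323] -/
theorem hfib_zero {φ : Fin d × Fin d → ℂ} (hφ : ∀ μ ν, φ (ν, μ) = -φ (μ, ν))
    (α : (Fin d → Fin n) → Fin d → ℂ) (hα : FibreConstraint n M 0 α) :
    (4 / Real.pi ^ 2) ^ d * ∑ a, ‖φ a‖ ^ 2 ≤ fibreEnergy n M 0 α φ := by
  classical
  have hn1 : 1 ≤ n := NeZero.one_le
  have he : ∀ μ, dSym n 0 (0 : Fin d → ℝ) μ = 0 := fun μ =>
    (dSym_eq_zero_iff n hn1 0 0 μ (by simp [Real.pi_nonneg])).mpr ⟨rfl, rfl⟩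
  set T : (Fin d → Fin n) → Fin d → Fin d → ℂ := fun k μ ν => if k = 0 then srcK n M 0 φ 0 μ ν else 0 with hT
  have hT0 : ∀ μ ν, T 0 μ ν = srcK n M 0 φ 0 μ ν := fun μ ν => by simp [hT]
  have hTk : ∀ k, k ≠ 0 → ∀ μ ν, T k μ ν = 0 := fun k hk μ ν => by simp [hT, hk]
  have hTa : ∀ k μ ν, T k ν μ = -T k μ ν := by
    intro k μ ν
    by_cases hk : k = 0
    · subst hk
      rw [hT0, hT0]
      exact srcK_antisymm n M 0 hφ 0 μ ν
    · rw [hTk k hk, hTk k hk, neg_zero]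
  have hfeas : ∀ k ν, 2 * ∑ μ, dSym n k (sOf M 0) μ * conj (T k μ ν) = (0 : Fin d → ℂ) ν * rK n M 0 k ν := by
    intro k ν
    rw [Pi.zero_apply, zero_mul]
    by_cases hk : k = 0
    · subst hk
      simp [he]
    · simp [hTk k hk]
  have h := weak_duality n M 0 φ α hα T hTa 0 hfeas
  calc (4 / Real.pi ^ 2) ^ d * ∑ a, ‖φ a‖ ^ 2 = ∑ μ, ∑ ν, (4 / Real.pi ^ 2) ^ d * ‖φ (μ, ν)‖ ^ 2 := by
        rw [Fintype.sum_prod_type, Finset.mul_sum]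
        exact Finset.sum_congr rfl fun μ _ => Finset.mul_sum _ _ _
    _ ≤ ∑ μ, ∑ ν, ‖srcK n M 0 φ 0 μ ν‖ ^ 2 :=
        Finset.sum_le_sum fun μ _ => Finset.sum_le_sum fun ν _ => norm_srcK_zero_sq_ge n M 0 hφ μ ν
    _ = ∑ k, ∑ μ, ∑ ν, (2 * (conj (T k μ ν) * srcK n M 0 φ k μ ν).re - ‖T k μ ν‖ ^ 2) := by
        symm
        rw [Finset.sum_eq_single (0 : Fin d → Fin n) (fun k _ hk => by simp [hTk k hk])
          (fun h0 => (h0 (Finset.mem_univ _)).elim)]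
        simp_rw [hT0, two_re_conj_mul_self_sub]
    _ ≤ fibreEnergy n M 0 α φ := h

/-- **The fibres p′ ≠ 0** (every n): `c(d)·Σ_a|φ_a|² ≤ E_{p′}(α, φ)` for antisymmetric φ and constrained α — the dual form of
(7.1.25)–(7.1.31): split φ = ∂^{(1)}B + f^⊥ (`decomp_allL`); test `dual_bound` with g = the central source of f^⊥ (τ₀: ≥ (4/π²)^d‖f^⊥‖²,
no cross term with ∂^{(1)}B because g is co-closed) and Λ = δ·`lamK` (τ₂ on the curl part: 2δQ − δ²Q with Q ≥ ε₁‖∂^{(1)}B‖², cross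
term |ΣΛ_νA_ν(f^⊥)| ≤ δ√Q·C₅‖f^⊥‖ absorbed for δ = δ(d)). [cite: BalabanImbrieJaffe1985, Theorem 7.1.1 p.321] -/
theorem hfib_ne_zero (hd : 0 < d) {q : Tor M} (hq : q ≠ 0) {φ : Fin d × Fin d → ℂ}
    (hφ : ∀ μ ν, φ (ν, μ) = -φ (μ, ν)) (α : (Fin d → Fin n) → Fin d → ℂ) (hα : FibreConstraint n M q α) :
    cAllL d * ∑ a, ‖φ a‖ ^ 2 ≤ fibreEnergy n M q α φ := by
  obtain ⟨B, ψ, hdec, hψ, h0⟩ := decomp_allL n M q hφ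
  have h0' : ∀ ν, ∑ μ, conj (dSym n 0 (sOf M q) μ) * srcK n M q ψ 0 μ ν = 0 := h0
  have hΔ := lapK_ne_zero n M hq
  have hw : 0 < (4 / Real.pi ^ 2) ^ d := by positivity
  have hC5 := cFiveSq_pos hd
  have hε₁ : 0 < epsOne d := epsOne_pos
  have hδ0 : 0 ≤ deltaC d := (deltaC_pos hd).le
  have hδ1 : deltaC d ≤ 1 := deltaC_le_one
  have hδC := deltaC_mul_cFiveSq_le hd
  -- the dual bound with g = the central source of ψ and Λ = the τ₂-multiplier of the curl part
  have hdb := dual_bound n M q φ hφ α hα hΔ (srcK n M q ψ 0) (srcK_antisymm n M q hψ 0) h0' (lamK n M q (deltaC d) B)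
    (lamK_orth n M hd hq (deltaC d) B)
  -- Term 1: the g-part is exactly Σ|g|² (the cross pairing with the curl part vanishes by co-closedness)
  have hsrc : ∀ μ ν, srcK n M q φ 0 μ ν = srcK n M q (curl1 M q B) 0 μ ν + srcK n M q ψ 0 μ ν := fun μ ν => by
    rw [hdec, srcK_add]
  have hcross : ∑ μ, ∑ ν, conj (srcK n M q ψ 0 μ ν) * srcK n M q (curl1 M q B) 0 μ ν = 0 := by
    simp_rw [srcK_curl1]
    rw [pairing_antisymm _ _ _ (srcK_antisymm n M q hψ 0)]
    have hz : ∀ ν, ∑ μ, dSym n 0 (sOf M q) μ * conj (srcK n M q ψ 0 μ ν) = 0 := fun ν => by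
      have h := congrArg conj (h0' ν)
      rw [map_sum, map_zero] at h
      simpa only [map_mul, Complex.conj_conj] using h
    simp_rw [hz, mul_zero, Finset.sum_const_zero, mul_zero]
  have hT1 : ∑ μ, ∑ ν, (2 * (conj (srcK n M q ψ 0 μ ν) * srcK n M q φ 0 μ ν).re - ‖srcK n M q ψ 0 μ ν‖ ^ 2)
      = ∑ μ, ∑ ν, ‖srcK n M q ψ 0 μ ν‖ ^ 2 := by
    have hterm : ∀ μ ν, 2 * (conj (srcK n M q ψ 0 μ ν) * srcK n M q φ 0 μ ν).re - ‖srcK n M q ψ 0 μ ν‖ ^ 2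
        = 2 * (conj (srcK n M q ψ 0 μ ν) * srcK n M q (curl1 M q B) 0 μ ν).re + ‖srcK n M q ψ 0 μ ν‖ ^ 2 := by
      intro μ ν
      rw [hsrc, mul_add, Complex.add_re, Complex.conj_mul', ← Complex.ofReal_pow, Complex.ofReal_re]
      ring
    simp_rw [hterm]
    rw [show (∑ μ, ∑ ν, (2 * (conj (srcK n M q ψ 0 μ ν) * srcK n M q (curl1 M q B) 0 μ ν).re
        + ‖srcK n M q ψ 0 μ ν‖ ^ 2)) = 2 * (∑ μ, ∑ ν, conj (srcK n M q ψ 0 μ ν) * srcK n M q (curl1 M q B) 0 μ ν).re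
        + ∑ μ, ∑ ν, ‖srcK n M q ψ 0 μ ν‖ ^ 2 by
      simp only [Complex.re_sum, Finset.mul_sum, Finset.sum_add_distrib], hcross, Complex.zero_re, mul_zero, zero_add]
  have hG2 : (4 / Real.pi ^ 2) ^ d * ∑ μ, ∑ ν, ‖ψ (μ, ν)‖ ^ 2 ≤ ∑ μ, ∑ ν, ‖srcK n M q ψ 0 μ ν‖ ^ 2 := by
    rw [Finset.mul_sum]
    refine Finset.sum_le_sum fun μ _ => ?_
    rw [Finset.mul_sum]
    exact Finset.sum_le_sum fun ν _ => norm_srcK_zero_sq_ge n M q hψ μ ν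
  -- Term 2: the Λ-part = δQ + cross term
  have hAK : ∑ ν, lamK n M q (deltaC d) B ν * AK n M q φ ν
      = ((deltaC d * qK n M q B : ℝ) : ℂ) + ∑ ν, lamK n M q (deltaC d) B ν * AK n M q ψ ν := by
    have h1 : ∀ ν, AK n M q φ ν = AK n M q (curl1 M q B) ν + AK n M q ψ ν := fun ν => by rw [hdec, AK_add]
    simp_rw [h1, mul_add]
    rw [Finset.sum_add_distrib, pairing_curl1 n M q B hΔ _ (lamK_orth n M hd hq (deltaC d) B), lamK_pair_B]
  have hΛ2 := sum_phiK_norm_lamK_sq n M hd hq hδ0 B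
  have hE : (∑ μ, ∑ ν, ‖srcK n M q ψ 0 μ ν‖ ^ 2)
      + (2 * (deltaC d * qK n M q B + (∑ ν, lamK n M q (deltaC d) B ν * AK n M q ψ ν).re)
        - deltaC d ^ 2 * qK n M q B) ≤ fibreEnergy n M q α φ := by
    have h := hdb
    rw [hT1, hAK, hΛ2, Complex.add_re, Complex.ofReal_re] at h
    exact h
  have hX2 := norm_lamK_pair_sq_le n M hd hq hδ0 B (AK n M q ψ)
  have hA5 := sum_AK_sq_div_phiK_le n M hd hq hψ h0
  have hQε := qK_ge n M hd hq B
  have hQ0 := qK_nonneg n M q B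
  -- abbreviations for the real bookkeeping
  set δ := deltaC d with hδdef
  set w := (4 / Real.pi ^ 2) ^ d with hwdef
  set Q := qK n M q B with hQdef
  set a2 := ∑ μ, ∑ ν, ‖ψ (μ, ν)‖ ^ 2 with ha2
  set b2 := ∑ μ, ∑ ν, ‖curl1 M q B (μ, ν)‖ ^ 2 with hb2
  set X := ∑ ν, lamK n M q δ B ν * AK n M q ψ ν with hXdef
  set G2 := ∑ μ, ∑ ν, ‖srcK n M q ψ 0 μ ν‖ ^ 2 with hG2def
  have ha0 : 0 ≤ a2 := Finset.sum_nonneg fun _ _ => Finset.sum_nonneg fun _ _ => sq_nonneg _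
  have hb0 : 0 ≤ b2 := Finset.sum_nonneg fun _ _ => Finset.sum_nonneg fun _ _ => sq_nonneg _
  -- the cross term: |X|² ≤ δ²Q·C₅²a2, hence 2|X| ≤ δ(Q/2 + 2C₅²a2)
  have hX2' : ‖X‖ ^ 2 ≤ δ ^ 2 * Q * (cFiveSq d * a2) :=
    hX2.trans (mul_le_mul_of_nonneg_left hA5 (mul_nonneg (sq_nonneg _) hQ0))
  have hrhs : 0 ≤ δ * (Q / 2 + 2 * cFiveSq d * a2) :=
    mul_nonneg hδ0 (by have := mul_nonneg (mul_nonneg zero_le_two hC5.le) ha0; linarith)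
  have hXb : 2 * ‖X‖ ≤ δ * (Q / 2 + 2 * cFiveSq d * a2) := by
    by_contra hcon
    have hlt := mul_self_lt_mul_self hrhs (not_le.mp hcon)
    nlinarith [sq_nonneg (δ * (Q / 2 - 2 * cFiveSq d * a2)), norm_nonneg X]
  have hre : -‖X‖ ≤ X.re := (abs_le.mp (Complex.abs_re_le_norm X)).1
  -- Σ_a |φ_a|² ≤ 2(a2 + b2)
  have hS : ∑ a, ‖φ a‖ ^ 2 ≤ 2 * b2 + 2 * a2 := by
    rw [Fintype.sum_prod_type, hb2, ha2, Finset.mul_sum, Finset.mul_sum, ← Finset.sum_add_distrib]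
    refine Finset.sum_le_sum fun μ _ => ?_
    rw [Finset.mul_sum, Finset.mul_sum, ← Finset.sum_add_distrib]
    refine Finset.sum_le_sum fun ν _ => ?_
    rw [hdec, Pi.add_apply]
    exact norm_add_sq_le_two _ _
  -- bookkeeping
  have h1 : 0 ≤ (δ - δ ^ 2) * Q := mul_nonneg (by nlinarith [mul_nonneg hδ0 (sub_nonneg.mpr hδ1)]) hQ0
  have h2 : 0 ≤ δ * (Q - epsOne d * b2) := mul_nonneg hδ0 (by linarith)
  have hm_w : min w (δ * epsOne d) ≤ w := min_le_left _ _
  have hm_δ : min w (δ * epsOne d) ≤ δ * epsOne d := min_le_right _ _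
  have hm0 : 0 ≤ min w (δ * epsOne d) := le_min hw.le (mul_nonneg hδ0 hε₁.le)
  have h3 : 0 ≤ (w - min w (δ * epsOne d)) * a2 := mul_nonneg (by linarith) ha0
  have h4 : 0 ≤ (δ * epsOne d - min w (δ * epsOne d)) * b2 := mul_nonneg (by linarith) hb0
  have h5 : 0 ≤ (w / 2 - 2 * δ * cFiveSq d) * a2 := mul_nonneg (by linarith) ha0
  have h6 : 0 ≤ min w (δ * epsOne d) * (2 * b2 + 2 * a2 - ∑ a, ‖φ a‖ ^ 2) := mul_nonneg hm0 (by linarith)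
  have hc : cAllL d = 1 / 4 * min w (δ * epsOne d) := rfl
  rw [hc]
  linarith [hE, hG2, hXb, hre, h1, h2, h3, h4, h5, h6, hQε]

/-- **THE FIBREWISE BOUND FOR EVERY BLOCK SIZE n** (d ≥ 1): for every unit momentum p′ of the torus, every antisymmetric φ and every
α obeying the fibre constraint (4.2.1), `c(d)·Σ_a|φ_a|² ≤ E_{p′}(α, φ)` with c(d) = `cAllL d` independent of n — the `hfib` input of
p27's `thm711_config_of_fibre_twoForm`; for odd n = 2M+1 this is the tree's `BIJ85Thm711ConfigSpace.hfib_twoForm` (another constant).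
[cite: BalabanImbrieJaffe1985, Theorem 7.1.1 p.321] -/
theorem hfib_twoForm_allL (hd : 0 < d) (q : Tor M) {φ : Fin d × Fin d → ℂ} (hφ : ∀ μ ν, φ (ν, μ) = -φ (μ, ν))
    (α : (Fin d → Fin n) → Fin d → ℂ) (hα : FibreConstraint n M q α) :
    cAllL d * ∑ a, ‖φ a‖ ^ 2 ≤ fibreEnergy n M q α φ := by
  by_cases hq : q = 0
  · subst hq
    have hS : 0 ≤ ∑ a, ‖φ a‖ ^ 2 := Finset.sum_nonneg fun a _ => sq_nonneg _
    exact (mul_le_mul_of_nonneg_right cAllL_le hS).trans (hfib_zero n M hφ α hα)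
  · exact hfib_ne_zero n M hd hq hφ α hα

end Fibre

/-! ## §5 Theorem 7.1.1 in configuration space, every block size -/

/-- **THEOREM 7.1.1 (p. 321) IN CONFIGURATION SPACE FOR EVERY BLOCK SIZE n = L^k (even L included)**, verbatim: *"There exists a
constant c > 0, independent of k, such that c ≤ σ_k."* — here: for every `d ≥ 1`, every `n ≥ 1`, every torus Π_μ(ℤ/nN_μ) (all
N_μ ≥ 1), every ANTISYMMETRIC plaquette field `f` on the unit torus and every `A` on the fine torus with `Q_kA = 0` (`QvOp`):
`c(d)·Σ|f|² ≤ η^d·Σ|∂^ηA − Q^{e*}_kf|²` with `c(d) = cAllL d` (independent of k, of the torus and of the fields), ∂^η = n·`curlC`,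
Q^{e*}_k = p27's `edgeAdjC`.  Proof = p27's fibre decomposition `thm711_config_of_fibre_twoForm` ((7.1.12), fibre energies over the
complete residue system of offsets) + `hfib_twoForm_allL`.  The tree's `thm711_configSpace` is the case n = 2M+1 (same shape,
another constant). [cite: BalabanImbrieJaffe1985, Theorem 7.1.1 p.321] -/
theorem thm711_configSpace_allL (hd : 0 < d) (n : ℕ) [NeZero n] {N : Fin d → ℕ} [∀ μ, NeZero (N μ)]
    (f : Tor N × (Fin d × Fin d) → ℂ) (hf : ∀ x μ ν, f (x, (ν, μ)) = -f (x, (μ, ν)))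
    (A : Tor (fine n N) × Fin d → ℂ) (hA : QvOp n N *ᵥ A = 0) :
    cAllL d * ∑ a, ‖f a‖ ^ 2 ≤ ((n : ℝ) ^ d)⁻¹ * ∑ b, ‖((n : ℂ) • (curlC (fine n N) *ᵥ A) - edgeAdjC n N *ᵥ f) b‖ ^ 2 :=
  thm711_config_of_fibre_twoForm n (fun q _ hφ α hα => hfib_twoForm_allL n N hd q hφ α hα) f hf A hA

/-- **THEOREM 7.1.1, existential form, every block size**: for every `d ≥ 1` there is ONE constant `c > 0` such that for every
n ≥ 1 (any parity), every torus, every antisymmetric `f` and every `A` with `Q_kA = 0`, `c·Σ|f|² ≤ η^dΣ|∂^ηA − Q^{e*}_kf|²` —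
*"independent of k"*. [cite: BalabanImbrieJaffe1985, Theorem 7.1.1 p.321] -/
theorem thm711_configSpace_allL_exists (hd : 0 < d) :
    ∃ c : ℝ, 0 < c ∧ ∀ (n : ℕ) [NeZero n] (M : Fin d → ℕ) [∀ μ, NeZero (M μ)] (f : Tor M × (Fin d × Fin d) → ℂ),
      (∀ x μ ν, f (x, (ν, μ)) = -f (x, (μ, ν))) → ∀ (A : Tor (fine n M) × Fin d → ℂ), QvOp n M *ᵥ A = 0 →
        c * ∑ a, ‖f a‖ ^ 2 ≤ ((n : ℝ) ^ d)⁻¹ * ∑ b, ‖((n : ℂ) • (curlC (fine n M) *ᵥ A) - edgeAdjC n M *ᵥ f) b‖ ^ 2 :=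
  ⟨cAllL d, cAllL_pos hd, fun n _ _ _ f hf A hA => thm711_configSpace_allL hd n f hf A hA⟩

end

end Literature.MathematicalPhysics.QuantumFieldTheory.BalabanImbrieJaffe1984to88.BIJ85Thm711AllL
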